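import Summits.QuantumFields.GaugeBoot.BootstrapSymmetryConsequences
import HarnessLib

/-!
# Symmetry reduction of the truncated bootstrap is lossless: for an invariant objective the symmetry-reduced SDP has exactly the same feasible values (gauge-boot, L1/L4 supplement)

HONEST FRAMING (cell `pub-gaugeboot`, page 1 of every file): the venture produces certified bounds
on lattice expectations at stated coupling, gauge group, dimension and torus size; NOT a mass gap,
NOT a continuum limit, NOT a string tension; NOT Yang–Mills-summit-bearing (barriers
`FixedCouplingUltralocality`, `PerturbativeInvisibility`). Structural; it certifies no number.

## Content

`BootstrapSymmetryConsequences.lean` introduced the symmetry-reduced SDP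
`symLevelValuesSuN N β n 𝓡 P` (level-`n` feasible functionals which are moreover invariant on the
level-`n` test functions under a family `𝓡` of configuration maps) and proved it is a SOUND
relaxation (`symLevelValues_subset_levelValues`, `wilson_mem_symLevelValues_suN`). This file proves
the converse inclusion for invariant objectives — the lattice form of Gatermann–Parrilo's theorem
that an invariant SDP and its fixed-point restriction have the same value:

* `comp_relabelCM_mem_wordsUpTo` / `comp_relabelCM_mem_wordTruncation` — relabelling the links
  maps words of length `≤ n` to words of length `≤ n`;
* ★ `IsBootstrapFeasible.comp_relabel` — a relabelling `U ↦ U ∘ π` (`π` a bijection of the links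
  compatible with the local actions, `S_e (U ∘ π) = S_{π e} U`) carries level-`V` feasible
  functionals to level-`V` feasible functionals whenever the test set `V` is relabelling stable
  (normalisation, positivity, and the truncated loop equations: the row of `f` at `e` for `φ ∘ π^*`
  is the row of `f ∘ π` at `π e` for `φ`);
* `avgFunctional` — the group average `(1/|Γ|) Σ_γ φ (· ∘ R_γ)` over a finite family of
  configuration maps closed under composition; ★ `avgFunctional_comp_eq` (the average is
  invariant), `avgFunctional_apply_of_invariant` (it agrees with `φ` on invariant observables),
  ★ `isBootstrapFeasible_avgFunctional` (feasibility is convex, so the average of feasible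
  functionals is feasible);
* ★★★ `symLevelValues_eq_levelValues_of_invariant_suN` — `SU(N)` on the torus `(ℤ/L)^d`, any real
  `β`, any level `n`, any finite family `γ ↦ U ∘ e_γ` of link relabellings closed under composition
  and preserving the Wilson action: for every objective `P` invariant under the family, the
  symmetry-reduced level-`n` feasible values of `P` ARE the level-`n` feasible values of `P` — the
  reduced SDP computes exactly the same upper and lower bounds;
* ★★★ `latticeSymLevelValues_eq_levelValues_suN` — the instance every practical lattice bootstrap
  uses: translations and axis permutations together (the orientation-preserving lattice symmetry
  group `S_d ⋉ (ℤ/L)^d`, `latticeRelabel (σ, a) = τ_a ∘ edgePerm σ`), for every `P` invariant under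
  all of them (`sSup`/`sInf` corollary `sSup_latticeSymLevelValues_eq_suN`).

What this is NOT: the site reflection `negReflectCM` (and the full hyperoctahedral group) is NOT
covered at fixed level — an orientation-reversing map turns a left one-link shift into a right
shift, whose loop equation at word level `n` involves test functions of length `n + 2`
(`RightShiftRows.lean`), so reflection invariance imposed at a fixed level is a genuine additional
cut (sound by `wilson_mem_symLevelValues_suN`; whether it changes the level-`n` value is not
claimed either way). Nothing about block-diagonalisation of the reduced SDP (representation
theory), rates, `L → ∞`.

References: K. Gatermann, P. A. Parrilo, J. Pure Appl. Algebra 192 (2004) 95, Thm 3.3 (invariant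
SDPs: the fixed-point restricted program has the same optimal value, by the Reynolds operator);
P. Anderson, M. Kruczenski, Nucl. Phys. B 921 (2017) §3; V. Kazakov, Z. Zheng, arXiv:2203.11360
§3.2 (symmetry reduction of the lattice bootstrap). Folklore.
-/

noncomputable section

open MeasureTheory Filter Topology NormedSpace
open Literature.MathematicalPhysics.QuantumFieldTheory (LatticeRep Site Edge GaugeConfig wilsonAction
  wilsonMeasure edgePerm sitePerm isProbabilityMeasure_wilsonMeasure)
open Literature.MathematicalPhysics.QuantumLattice

namespace Summit.QuantumFields.GaugeBoot

/-! ## Relabellings preserve the word truncation and level-`V` feasibility -/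

section Relabel

variable {ι : Type*} [DecidableEq ι] {G : Type*} [Group G] [TopologicalSpace G] (r : LatticeRep G)

omit [DecidableEq ι] in
/-- A generator relabelled is a generator. -/
theorem comp_relabelCM_mem_entryGens (π : ι → ι) {x : C(ι → G, ℝ)} (hx : x ∈ entryGens (ι := ι) r) :
    x.comp (relabelCM π) ∈ entryGens (ι := ι) r := by
  rcases hx with ⟨⟨e, a, b⟩, rfl⟩ | ⟨⟨e, a, b⟩, rfl⟩
  · exact Or.inl ⟨(π e, a, b), by ext U; rfl⟩
  · exact Or.inr ⟨(π e, a, b), by ext U; rfl⟩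

omit [DecidableEq ι] in
/-- **Relabelling maps words of length `≤ n` to words of length `≤ n`.** -/
theorem comp_relabelCM_mem_wordsUpTo (π : ι → ι) {n : ℕ} {w : C(ι → G, ℝ)}
    (hw : w ∈ wordsUpTo (ι := ι) r n) : w.comp (relabelCM π) ∈ wordsUpTo (ι := ι) r n := by
  obtain ⟨l, hl, hlen, rfl⟩ := hw
  refine ⟨l.map (ContinuousMap.compRightAlgHom ℝ ℝ (relabelCM (G := G) π)), ?_, by simpa using hlen, ?_⟩
  · intro x hx
    obtain ⟨y, hy, rfl⟩ := List.mem_map.1 hx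
    exact comp_relabelCM_mem_entryGens r π (hl y hy)
  · rw [← map_list_prod]
    rfl

omit [DecidableEq ι] in
/-- **The word truncation is relabelling stable.** -/
theorem comp_relabelCM_mem_wordTruncation (π : ι → ι) {n : ℕ} {v : C(ι → G, ℝ)}
    (hv : v ∈ wordTruncation (ι := ι) r n) : v.comp (relabelCM π) ∈ wordTruncation (ι := ι) r n := by
  have h : Submodule.span ℝ (wordsUpTo (ι := ι) r n) ≤
      (Submodule.span ℝ (wordsUpTo (ι := ι) r n)).comap
        (ContinuousMap.compRightAlgHom ℝ ℝ (relabelCM (G := G) π)).toLinearMap :=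
    Submodule.span_le.2 fun w hw => Submodule.subset_span (comp_relabelCM_mem_wordsUpTo r π hw)
  exact h hv

variable {K : Type*} {k : K → ℝ → G} {S : ι → (ι → G) → ℝ} {β : ℝ}

/-- ★ **Relabelling a level-`V` feasible functional gives a level-`V` feasible functional**: for a
bijection `π` of the links compatible with the local actions (`S_e (U ∘ π) = S_{π e} U`) and a
relabelling-stable test set `V`, `f ↦ φ (f ∘ π)` is feasible whenever `φ` is (the row of `f` at `e`
for the new functional is the row of `f ∘ π` at `π e` for `φ`). [cite: GatermannParrilo2004, Thm 3.3
(condition (i): the group maps feasible points to feasible points)] -/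
theorem IsBootstrapFeasible.comp_relabel (π : ι ≃ ι) (hS : ∀ e U, S e (relabelCM (G := G) π U) = S (π e) U)
    {V : Set C(ι → G, ℝ)} (hV : ∀ v ∈ V, v.comp (relabelCM (G := G) π) ∈ V)
    {φ : C(ι → G, ℝ) →ₗ[ℝ] ℝ} (hφ : IsBootstrapFeasible r k S β V φ) :
    IsBootstrapFeasible r k S β V
      (φ ∘ₗ (ContinuousMap.compRightAlgHom ℝ ℝ (relabelCM (G := G) π)).toLinearMap) := by
  refine ⟨?_, fun v hv => ?_, fun e a => ?_⟩
  · change φ ((1 : C(ι → G, ℝ)).comp (relabelCM (G := G) π)) = 1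
    exact hφ.1
  · change 0 ≤ φ ((v * v).comp (relabelCM (G := G) π))
    exact hφ.2.1 _ (hV v hv)
  obtain ⟨S', hS'm, hS', -⟩ := hφ.2.2 e a
  obtain ⟨S'', -, hS'', hrows⟩ := hφ.2.2 (π e) a
  refine ⟨S', hS'm, hS', fun f hf f' hf'm hf' => ?_⟩
  have hSe : ∀ U, S'' U = S' (relabelCM (G := G) π U) := fun U =>
    (hS'' U).unique (hasDerivAt_action_relabel π hS a e hS' U)
  have hrow := hrows (f.comp (relabelCM π)) (hV f hf) (f'.comp (relabelCM π))
    (comp_relabelCM_mem_polyAlgebra r π hf'm) (fun U => hasDerivAt_comp_relabelCM π (κ := k a) e hf' U)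
  have hprod : f.comp (relabelCM (G := G) π) * S'' = (f * S').comp (relabelCM (G := G) π) := by
    ext U
    simp only [ContinuousMap.mul_apply, ContinuousMap.comp_apply, hSe U]
  rw [hprod] at hrow
  exact hrow

end Relabel

/-! ## Group averaging of functionals -/

section Average

variable {ι : Type*} {G : Type*} [TopologicalSpace G] {Γ : Type*} [Fintype Γ]

/-- **The group average** of a functional over a finite family of configuration maps:
`(1/|Γ|) Σ_γ φ (· ∘ R_γ)` (the Reynolds operator on the moment side). [cite: GatermannParrilo2004,
proof of Thm 3.3] -/
def avgFunctional (R : Γ → C(ι → G, ι → G)) (φ : C(ι → G, ℝ) →ₗ[ℝ] ℝ) : C(ι → G, ℝ) →ₗ[ℝ] ℝ :=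
  (Fintype.card Γ : ℝ)⁻¹ • ∑ γ, φ ∘ₗ (ContinuousMap.compRightAlgHom ℝ ℝ (R γ)).toLinearMap

/-- `avgFunctional` evaluated. -/
theorem avgFunctional_apply (R : Γ → C(ι → G, ι → G)) (φ : C(ι → G, ℝ) →ₗ[ℝ] ℝ) (f : C(ι → G, ℝ)) :
    avgFunctional R φ f = (Fintype.card Γ : ℝ)⁻¹ * ∑ γ, φ (f.comp (R γ)) := by
  simp only [avgFunctional, LinearMap.smul_apply, LinearMap.coe_sum, Finset.sum_apply,
    LinearMap.coe_comp, Function.comp_apply, smul_eq_mul]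
  rfl

/-- **On invariant observables the average agrees with the functional.** -/
theorem avgFunctional_apply_of_invariant [Nonempty Γ] (R : Γ → C(ι → G, ι → G))
    (φ : C(ι → G, ℝ) →ₗ[ℝ] ℝ) {f : C(ι → G, ℝ)} (hf : ∀ γ, f.comp (R γ) = f) :
    avgFunctional R φ f = φ f := by
  rw [avgFunctional_apply]
  simp only [hf, Finset.sum_const, Finset.card_univ, nsmul_eq_mul]
  have h : (Fintype.card Γ : ℝ) ≠ 0 := Nat.cast_ne_zero.2 Fintype.card_ne_zero
  field_simp

/-- ★ **The average is invariant** when composition with each map of the family permutes the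
family (`R_δ ∘ R_γ = R_{e γ}` for a bijection `e` of the indices — e.g. a group acting).
[cite: GatermannParrilo2004, proof of Thm 3.3] -/
theorem avgFunctional_comp_eq (R : Γ → C(ι → G, ι → G))
    (hR : ∀ δ, ∃ e : Γ ≃ Γ, ∀ γ, (R δ).comp (R γ) = R (e γ))
    (φ : C(ι → G, ℝ) →ₗ[ℝ] ℝ) (δ : Γ) (f : C(ι → G, ℝ)) :
    avgFunctional R φ (f.comp (R δ)) = avgFunctional R φ f := by
  obtain ⟨e, he⟩ := hR δ
  rw [avgFunctional_apply, avgFunctional_apply]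
  congr 1
  have h : ∀ γ, (f.comp (R δ)).comp (R γ) = f.comp (R (e γ)) := fun γ => by
    rw [ContinuousMap.comp_assoc, he γ]
  simp_rw [h]
  exact Fintype.sum_equiv e _ _ fun γ => rfl

end Average

section AverageFeasible

variable {ι : Type*} [DecidableEq ι] {G : Type*} [Group G] [TopologicalSpace G] (r : LatticeRep G)
  {Γ : Type*} [Fintype Γ] {K : Type*} {k : K → ℝ → G} {S : ι → (ι → G) → ℝ} {β : ℝ}

/-- **Feasibility is convex**: a convex combination of level-`V` feasible functionals is feasible
(the derivative of each local action being unique, all the functionals' rows refer to the same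
`S'`). -/
theorem isBootstrapFeasible_sum_smul [Nonempty Γ] {V : Set C(ι → G, ℝ)} (w : Γ → ℝ) (hw : ∀ γ, 0 ≤ w γ)
    (hw1 : ∑ γ, w γ = 1) (φ : Γ → (C(ι → G, ℝ) →ₗ[ℝ] ℝ))
    (hφ : ∀ γ, IsBootstrapFeasible r k S β V (φ γ)) :
    IsBootstrapFeasible r k S β V (∑ γ, w γ • φ γ) := by
  refine ⟨?_, fun v hv => ?_, fun i a => ?_⟩
  · simp only [LinearMap.coe_sum, Finset.sum_apply, LinearMap.smul_apply, smul_eq_mul,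
      (hφ _).1, mul_one, hw1]
  · simp only [LinearMap.coe_sum, Finset.sum_apply, LinearMap.smul_apply, smul_eq_mul]
    exact Finset.sum_nonneg fun γ _ => mul_nonneg (hw γ) ((hφ γ).2.1 v hv)
  obtain ⟨S', hS'm, hS', -⟩ := (hφ (Classical.arbitrary Γ)).2.2 i a
  refine ⟨S', hS'm, hS', fun f hf f' hf'm hf' => ?_⟩
  have hrow : ∀ γ, φ γ f' = β * φ γ (f * S') := by
    intro γ
    obtain ⟨S'', -, hS'', hrows⟩ := (hφ γ).2.2 i a
    have he : S'' = S' := ContinuousMap.ext fun U => (hS'' U).unique (hS' U)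
    rw [← he]
    exact hrows f hf f' hf'm hf'
  simp only [LinearMap.coe_sum, Finset.sum_apply, LinearMap.smul_apply, smul_eq_mul, hrow,
    Finset.mul_sum]
  exact Finset.sum_congr rfl fun γ _ => by ring

/-- ★ **The group average of a functional whose translates are all feasible is feasible.**
[cite: GatermannParrilo2004, proof of Thm 3.3] -/
theorem isBootstrapFeasible_avgFunctional [Nonempty Γ] {V : Set C(ι → G, ℝ)} (R : Γ → C(ι → G, ι → G))
    {φ : C(ι → G, ℝ) →ₗ[ℝ] ℝ}
    (hφ : ∀ γ, IsBootstrapFeasible r k S β V (φ ∘ₗ (ContinuousMap.compRightAlgHom ℝ ℝ (R γ)).toLinearMap)) :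
    IsBootstrapFeasible r k S β V (avgFunctional R φ) := by
  have hc : (0 : ℝ) < Fintype.card Γ := Nat.cast_pos.2 Fintype.card_pos
  have h := isBootstrapFeasible_sum_smul r (V := V) (fun _ : Γ => (Fintype.card Γ : ℝ)⁻¹)
    (fun _ => inv_nonneg.2 hc.le) (by
      rw [Finset.sum_const, Finset.card_univ, nsmul_eq_mul, mul_inv_cancel₀ hc.ne']) _ hφ
  have he : (∑ γ, (Fintype.card Γ : ℝ)⁻¹ • (φ ∘ₗ (ContinuousMap.compRightAlgHom ℝ ℝ (R γ)).toLinearMap)) =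
      avgFunctional R φ := by
    rw [avgFunctional, Finset.smul_sum]
  rwa [he] at h

end AverageFeasible

/-! ## The orientation-preserving lattice symmetries: translations and axis permutations -/

section Lattice

variable {d L : ℕ}


/-- **The orientation-preserving lattice symmetry** indexed by `(σ, a) ∈ S_d × (ℤ/L)^d`: the link
bijection `τ_a ∘ edgePerm σ`, `(x, i) ↦ (σ·x + a, σ i)`. [folklore] -/
def latticeRelabel (p : Equiv.Perm (Fin d) × Site d L) : Edge d L ≃ Edge d L :=
  (edgePerm (L := L) p.1).trans (translateEquiv p.2)

/-- `latticeRelabel` evaluated. -/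
@[simp] theorem latticeRelabel_apply (σ : Equiv.Perm (Fin d)) (a : Site d L) (x : Edge d L) :
    latticeRelabel (σ, a) x = (sitePerm (L := L) σ x.1 + a, σ x.2) := by
  simp only [latticeRelabel, Equiv.trans_apply, edgePerm_apply, translateEquiv_apply]

/-- **Closure under composition** (the semidirect product law):
`(τ_b ∘ e_τ) ∘ (τ_a ∘ e_σ) = τ_{b + τ·a} ∘ e_{τσ}`. -/
theorem latticeRelabel_comp (σ τ : Equiv.Perm (Fin d)) (a b : Site d L) :
    (⇑(latticeRelabel (L := L) (τ, b))) ∘ (⇑(latticeRelabel (σ, a))) =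
      ⇑(latticeRelabel (τ * σ, b + sitePerm (L := L) τ a)) := by
  funext x
  simp only [Function.comp_apply, latticeRelabel_apply]
  have h : sitePerm (L := L) τ (sitePerm (L := L) σ x.1) = sitePerm (L := L) (τ * σ) x.1 := by
    funext j; rfl
  refine Prod.ext ?_ rfl
  change sitePerm (L := L) τ (sitePerm (L := L) σ x.1 + a) + b =
    sitePerm (L := L) (τ * σ) x.1 + (b + sitePerm (L := L) τ a)
  rw [Literature.MathematicalPhysics.QuantumFieldTheory.sitePerm_add, h]
  abel

/-- Composition with a fixed lattice symmetry permutes the family. -/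
theorem latticeRelabel_closed (δ : Equiv.Perm (Fin d) × Site d L) :
    ∃ g : (Equiv.Perm (Fin d) × Site d L) ≃ (Equiv.Perm (Fin d) × Site d L),
      ∀ γ, (⇑(latticeRelabel (L := L) γ)) ∘ (⇑(latticeRelabel δ)) = ⇑(latticeRelabel (g γ)) := by
  refine ⟨Equiv.prodShear (Equiv.mulRight δ.1) (fun τ => Equiv.addRight (sitePerm (L := L) τ δ.2)),
    fun γ => ?_⟩
  rw [latticeRelabel_comp]
  rfl

end Lattice

/-! ## `SU(N)` on the torus: the reduced SDP is lossless for invariant objectives -/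

section SuN

variable {d L : ℕ} [NeZero L] (N : ℕ) (β : ℝ) (n : ℕ)

/-- ★★★ **Symmetry reduction is lossless** (`SU(N)`, torus `(ℤ/L)^d`, any real `β`, any level `n`).
Let `γ ↦ e_γ` be a finite family of bijections of the links, closed under composition up to a
permutation of the indices, each preserving the Wilson action (`S_W (U ∘ e_γ) = S_W U`). For every
objective `P` invariant under the family, the level-`n` feasible values of `P` with the invariance
`φ (v ∘ e_γ) = φ v` IMPOSED on the test functions coincide with the plain level-`n` feasible values
of `P`: the reduced SDP has exactly the same optimal values. [cite: GatermannParrilo2004, Thm 3.3] -/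
theorem symLevelValues_eq_levelValues_of_invariant_suN {Γ : Type*} [Fintype Γ] [Nonempty Γ]
    (e : Γ → (Edge d L ≃ Edge d L))
    (hmul : ∀ δ, ∃ g : Γ ≃ Γ, ∀ γ, (⇑(e γ)) ∘ (⇑(e δ)) = ⇑(e (g γ)))
    (hS : ∀ γ (U : GaugeConfig d L (Matrix.specialUnitaryGroup (Fin N) ℂ)),
      wilsonAction (fundamentalRep (Fin N)) (U ∘ e γ) = wilsonAction (fundamentalRep (Fin N)) U)
    {P : C(GaugeConfig d L (Matrix.specialUnitaryGroup (Fin N) ℂ), ℝ)}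
    (hP : ∀ γ, P.comp (relabelCM (G := Matrix.specialUnitaryGroup (Fin N) ℂ) (e γ)) = P) :
    symLevelValuesSuN (d := d) (L := L) N β n
        (Set.range fun γ => relabelCM (G := Matrix.specialUnitaryGroup (Fin N) ℂ) (e γ)) P =
      levelValuesSuN (d := d) (L := L) N β n P := by
  refine Set.Subset.antisymm (symLevelValues_subset_levelValues N β n _ P) ?_
  rintro t ⟨φ, hφ, rfl⟩
  set R : Γ → C(GaugeConfig d L (Matrix.specialUnitaryGroup (Fin N) ℂ),
      GaugeConfig d L (Matrix.specialUnitaryGroup (Fin N) ℂ)) :=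
    fun γ => relabelCM (G := Matrix.specialUnitaryGroup (Fin N) ℂ) (e γ) with hRdef
  have hR : ∀ δ, ∃ g : Γ ≃ Γ, ∀ γ, (R δ).comp (R γ) = R (g γ) := by
    intro δ
    obtain ⟨g, hg⟩ := hmul δ
    refine ⟨g, fun γ => ?_⟩
    ext U ℓ
    have h := congrFun (hg γ) ℓ
    simp only [Function.comp_apply] at h
    simp only [hRdef, ContinuousMap.comp_apply, relabelCM_apply, h]
  -- every translate of `φ` is feasible
  have hfeas : ∀ γ, IsBootstrapFeasible (fundamentalLatticeRep N) (suExp N)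
      (fun _ => wilsonAction (fundamentalRep (Fin N))) β
      (wordTruncation (ι := Edge d L) (fundamentalLatticeRep N) n)
      (φ ∘ₗ (ContinuousMap.compRightAlgHom ℝ ℝ (R γ)).toLinearMap) := fun γ =>
    hφ.comp_relabel (fundamentalLatticeRep N) (e γ) (fun _ U => hS γ U)
      (fun v hv => comp_relabelCM_mem_wordTruncation (fundamentalLatticeRep N) _ hv)
  refine ⟨avgFunctional R φ, isBootstrapFeasible_avgFunctional (fundamentalLatticeRep N) R hfeas, ?_,
    avgFunctional_apply_of_invariant R φ hP⟩
  rintro _ ⟨δ, rfl⟩ v -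
  exact avgFunctional_comp_eq R hR φ δ v

/-- **Corollary: the reduced SDP has the same optimal values.** -/
theorem sSup_symLevelValues_eq_of_invariant_suN {Γ : Type*} [Fintype Γ] [Nonempty Γ]
    (e : Γ → (Edge d L ≃ Edge d L))
    (hmul : ∀ δ, ∃ g : Γ ≃ Γ, ∀ γ, (⇑(e γ)) ∘ (⇑(e δ)) = ⇑(e (g γ)))
    (hS : ∀ γ (U : GaugeConfig d L (Matrix.specialUnitaryGroup (Fin N) ℂ)),
      wilsonAction (fundamentalRep (Fin N)) (U ∘ e γ) = wilsonAction (fundamentalRep (Fin N)) U)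
    {P : C(GaugeConfig d L (Matrix.specialUnitaryGroup (Fin N) ℂ), ℝ)}
    (hP : ∀ γ, P.comp (relabelCM (G := Matrix.specialUnitaryGroup (Fin N) ℂ) (e γ)) = P) :
    sSup (symLevelValuesSuN (d := d) (L := L) N β n
        (Set.range fun γ => relabelCM (G := Matrix.specialUnitaryGroup (Fin N) ℂ) (e γ)) P) =
      sSup (levelValuesSuN (d := d) (L := L) N β n P) ∧
    sInf (symLevelValuesSuN (d := d) (L := L) N β n
        (Set.range fun γ => relabelCM (G := Matrix.specialUnitaryGroup (Fin N) ℂ) (e γ)) P) =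
      sInf (levelValuesSuN (d := d) (L := L) N β n P) := by
  rw [symLevelValues_eq_levelValues_of_invariant_suN N β n e hmul hS hP]
  exact ⟨rfl, rfl⟩

/-- The Wilson action is invariant under every orientation-preserving lattice symmetry. -/
theorem wilsonAction_comp_latticeRelabel (p : Equiv.Perm (Fin d) × Site d L)
    (U : GaugeConfig d L (Matrix.specialUnitaryGroup (Fin N) ℂ)) :
    wilsonAction (fundamentalRep (Fin N)) (U ∘ latticeRelabel p) =
      wilsonAction (fundamentalRep (Fin N)) U := by
  have h : (U ∘ latticeRelabel p) = (U ∘ translateEquiv p.2) ∘ edgePerm (L := L) p.1 := rfl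
  rw [h, wilsonAction_comp_edgePerm (fundamentalRep (Fin N)) (continuous_fundamentalRep _) p.1,
    wilsonAction_comp_translateEquiv]

/-- ★★★ **The lattice-symmetry-reduced SDP is lossless** (`SU(N)`, torus `(ℤ/L)^d`, any real `β`,
any level `n`): for an objective `P` invariant under all translations and axis permutations — e.g.
the lattice average of a Wilson loop over its symmetry orbit, the mean plaquette — the feasible
values of `P` in the word-level-`n` SDP with translation and axis-permutation invariance imposed
are exactly the plain level-`n` feasible values: identifying Wilson loops modulo the
orientation-preserving lattice symmetries costs nothing and gains nothing at every level.
[cite: GatermannParrilo2004, Thm 3.3] -/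
theorem latticeSymLevelValues_eq_levelValues_suN
    {P : C(GaugeConfig d L (Matrix.specialUnitaryGroup (Fin N) ℂ), ℝ)}
    (hP : ∀ p : Equiv.Perm (Fin d) × Site d L,
      P.comp (relabelCM (G := Matrix.specialUnitaryGroup (Fin N) ℂ) (latticeRelabel p)) = P) :
    symLevelValuesSuN (d := d) (L := L) N β n
        (Set.range fun p : Equiv.Perm (Fin d) × Site d L =>
          relabelCM (G := Matrix.specialUnitaryGroup (Fin N) ℂ) (latticeRelabel p)) P =
      levelValuesSuN (d := d) (L := L) N β n P :=
  symLevelValues_eq_levelValues_of_invariant_suN N β n latticeRelabel latticeRelabel_closed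
    (wilsonAction_comp_latticeRelabel N) hP

/-- **Corollary: identical SDP bounds** for lattice-invariant objectives. -/
theorem sSup_latticeSymLevelValues_eq_suN
    {P : C(GaugeConfig d L (Matrix.specialUnitaryGroup (Fin N) ℂ), ℝ)}
    (hP : ∀ p : Equiv.Perm (Fin d) × Site d L,
      P.comp (relabelCM (G := Matrix.specialUnitaryGroup (Fin N) ℂ) (latticeRelabel p)) = P) :
    sSup (symLevelValuesSuN (d := d) (L := L) N β n
        (Set.range fun p : Equiv.Perm (Fin d) × Site d L =>
          relabelCM (G := Matrix.specialUnitaryGroup (Fin N) ℂ) (latticeRelabel p)) P) =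
      sSup (levelValuesSuN (d := d) (L := L) N β n P) ∧
    sInf (symLevelValuesSuN (d := d) (L := L) N β n
        (Set.range fun p : Equiv.Perm (Fin d) × Site d L =>
          relabelCM (G := Matrix.specialUnitaryGroup (Fin N) ℂ) (latticeRelabel p)) P) =
      sInf (levelValuesSuN (d := d) (L := L) N β n P) := by
  rw [latticeSymLevelValues_eq_levelValues_suN N β n hP]
  exact ⟨rfl, rfl⟩

/-- ★★ **Translations alone** (the reduction "Wilson loops modulo translations"): for a
translation-invariant objective the translation-reduced level-`n` SDP is lossless. -/
theorem translationSymLevelValues_eq_levelValues_suN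
    {P : C(GaugeConfig d L (Matrix.specialUnitaryGroup (Fin N) ℂ), ℝ)}
    (hP : ∀ a : Site d L, P.comp (relabelCM (G := Matrix.specialUnitaryGroup (Fin N) ℂ) (translateEquiv a)) = P) :
    symLevelValuesSuN (d := d) (L := L) N β n
        (Set.range fun a : Site d L =>
          relabelCM (G := Matrix.specialUnitaryGroup (Fin N) ℂ) (translateEquiv a)) P =
      levelValuesSuN (d := d) (L := L) N β n P := by
  haveI : Nonempty (Site d L) := ⟨0⟩
  refine symLevelValues_eq_levelValues_of_invariant_suN N β n translateEquiv (fun b => ?_)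
    (fun a U => wilsonAction_comp_translateEquiv (fundamentalRep (Fin N)) a U) hP
  refine ⟨Equiv.addRight b, fun a => funext fun x => ?_⟩
  simp only [Function.comp_apply, translateEquiv_apply, Equiv.coe_addRight]
  refine Prod.ext ?_ rfl
  change x.1 + b + a = x.1 + (a + b)
  abel

end SuN

end Summit.QuantumFields.GaugeBoot

end
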